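import Summits.ValiantsHypothesis.ValiantsHypothesis.Theorems.KPlusLogSqLawWeakLiftingTowerGraftTwoSidedLowerFamily
import Summits.ValiantsHypothesis.ValiantsHypothesis.Theorems.KPlusLogSqLawWeakLiftingTowerGraftTwoSidedClusteredLower

/-!
# Tower graft line — LOWER letters: the census laws for DEFINITE-TYPE roots of ANY CORANK

Crux `stmt-ValiantsHypothesis-19561` (`WeakLifting`), line (B) `tower_graft`, two-sided word instrument; seat val-sym-lift-p3 g21,
`--supports 19561`, NO stub claimed.  Mirror of `…TwoSidedDefiniteAny` in the lower currency of `…TwoSidedClusteredLower` (exponent vector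
`Matrix.vecCons (d₀+a+b) (Matrix.vecCons (d₀+a) (fun l => d₀ + γ l))`, letters `Matrix.vecCons C (Matrix.vecCons J P)`): the ABSTRACT
theorem `card_posRoots_le_of_posType_family_law_lower` (any exiting-type family law `R` ⇒ `Z₊ ≤ 2R` with multiplicity for definite-type
roots of any corank; orthogonal kernel bases for the type form `b t^{a+b} C − Σₗ (a−γₗ) t^{γₗ} Pₗ`, `Inertia.sum_corank_eq_card_roots_filter`,
`Inertia.global_index_formula`) and its instances ★ `card_posRoots_le_two_mul_clustered_lower_of_definite` (`2m`; #6's `hcorank` removed)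
and ★ `card_posRoots_le_commensurable_lower_of_definite` (`2(m + m Σₗ ⌊qₗ/2⌋)`; #11's `hcorank` removed and constant halved).
HONEST FRAMING: structural laws for one-pivot words; neutral kernel vectors untreated; nothing on S4…S5, `TowerB`, `WeakLifting` in its
window, Conjecture B, 18050 or `VP ≠ VNP`.  Def-free.

[folklore] the inertia kit + reflected split certificates.
-/

set_option linter.dupNamespace false
set_option autoImplicit false

namespace Summit.ValiantsHypothesis.ValiantsHypothesis.Theorems.KPlusLogSqLaw.TowerGraft

open Matrix
open scoped BigOperators

namespace TwoSidedThree

/-! ## The abstract definite-type census in the LOWER currency (mirror of `card_posRoots_le_of_negType_family_law`) -/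

section LowerDefiniteAny

open Polynomial
open Summit.ValiantsHypothesis.ValiantsHypothesis.Theorems.LacunarySymmetroidMatrixDescartes

variable {m L : ℕ}

/-- **ABSTRACT DEFINITE-TYPE CENSUS, lower currency.**  Word `F(X) = Σₗ X^{d₀+γₗ} Pₗ + X^{d₀+a} J + X^{d₀+a+b} C` (`C ≻ 0` on top, `J` ANY
symmetric, `Pₗ ⪰ 0` below the pivot with `γₗ < a`, a positive definite BOTTOM letter `P_{l₀}`, `b ≥ 1`).  HYPOTHESIS `hlaw`: every family of
EXITING-type kernel pairs of the reduced word (index types in `Type`; scales may repeat; same-scale pairs polarised for the type form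
`b τ^{a+b} C − Σₗ (a − γₗ)τ^{γₗ} Pₗ`) has at most `R` members.  CONCLUSION: definite type at every positive root ⇒ `Z₊ ≤ 2R` with multiplicity.
[folklore] -/
theorem card_posRoots_le_of_posType_family_law_lower (C J : Matrix (Fin m) (Fin m) ℝ) (P : Fin L → Matrix (Fin m) (Fin m) ℝ)
    (hC : C.PosDef) (hJ : J.IsSymm) (hP : ∀ l, (P l).PosSemidef) (l₀ : Fin L) (hbot : (P l₀).PosDef)
    (d₀ a b : ℕ) (γ : Fin L → ℕ) (hb : 0 < b) (hγa : ∀ l, γ l < a) (hγbot : ∀ l, l ≠ l₀ → γ l₀ < γ l) (R : ℕ)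
    (hlaw : ∀ (I : Type) [Fintype I] [DecidableEq I] (τ : I → ℝ) (u : I → Fin m → ℝ), (∀ i, 0 < τ i) →
      (∀ i, (∑ l, τ i ^ γ l • P l + τ i ^ a • J + τ i ^ (a + b) • C) *ᵥ u i = 0) →
      (∀ i, ∑ l, ((a - γ l : ℕ) : ℝ) * τ i ^ γ l * (u i ⬝ᵥ (P l *ᵥ u i)) < b * τ i ^ (a + b) * (u i ⬝ᵥ (C *ᵥ u i))) →
      (∀ i k, i ≠ k → τ i = τ k →
        (b : ℝ) * τ k ^ (a + b) * (u i ⬝ᵥ (C *ᵥ u k)) = ∑ l, ((a - γ l : ℕ) : ℝ) * τ k ^ γ l * (u i ⬝ᵥ (P l *ᵥ u k))) →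
      Fintype.card I ≤ R)
    (htype : ∀ t : ℝ, 0 < t →
      (∑ k : Fin (L + 2), t ^ (Matrix.vecCons (d₀ + a + b) (Matrix.vecCons (d₀ + a) fun l => d₀ + γ l) k) •
        (Matrix.vecCons C (Matrix.vecCons J P) k)).det = 0 →
      (∀ u : Fin m → ℝ, (∑ k : Fin (L + 2), t ^ (Matrix.vecCons (d₀ + a + b) (Matrix.vecCons (d₀ + a) fun l => d₀ + γ l) k) •
          (Matrix.vecCons C (Matrix.vecCons J P) k)) *ᵥ u = 0 → u ≠ 0 →
        (derivative (∑ k : Fin (L + 2), Polynomial.C (u ⬝ᵥ ((Matrix.vecCons C (Matrix.vecCons J P) k) *ᵥ u)) *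
          (X : ℝ[X]) ^ (Matrix.vecCons (d₀ + a + b) (Matrix.vecCons (d₀ + a) fun l => d₀ + γ l) k))).eval t < 0) ∨
      (∀ u : Fin m → ℝ, (∑ k : Fin (L + 2), t ^ (Matrix.vecCons (d₀ + a + b) (Matrix.vecCons (d₀ + a) fun l => d₀ + γ l) k) •
          (Matrix.vecCons C (Matrix.vecCons J P) k)) *ᵥ u = 0 → u ≠ 0 →
        0 < (derivative (∑ k : Fin (L + 2), Polynomial.C (u ⬝ᵥ ((Matrix.vecCons C (Matrix.vecCons J P) k) *ᵥ u)) *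
          (X : ℝ[X]) ^ (Matrix.vecCons (d₀ + a + b) (Matrix.vecCons (d₀ + a) fun l => d₀ + γ l) k))).eval t)) :
    Multiset.card ((Matrix.det (∑ k : Fin (L + 2),
        ((X : ℝ[X]) ^ (Matrix.vecCons (d₀ + a + b) (Matrix.vecCons (d₀ + a) fun l => d₀ + γ l) k)) •
          (Matrix.vecCons C (Matrix.vecCons J P) k).map Polynomial.C)).roots.filter (fun t => 0 < t)) ≤ 2 * R := by
  classical
  set dv : Fin (L + 2) → ℕ := Matrix.vecCons (d₀ + a + b) (Matrix.vecCons (d₀ + a) fun l => d₀ + γ l) with hdv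
  set Sv : Fin (L + 2) → Matrix (Fin m) (Fin m) ℝ := Matrix.vecCons C (Matrix.vecCons J P) with hSv
  have hCs : C.IsSymm := by
    have h1 := hC.1; unfold Matrix.IsHermitian at h1
    rwa [Matrix.conjTranspose_eq_transpose_of_trivial] at h1
  have hPs : ∀ l, (P l).IsSymm := by
    intro l; have h1 := (hP l).1; unfold Matrix.IsHermitian at h1
    rwa [Matrix.conjTranspose_eq_transpose_of_trivial] at h1
  have hS : ∀ k, (Sv k).IsSymm := by
    intro k
    refine Fin.cases ?_ (fun k => ?_) k
    · simpa [hSv] using hCs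
    · refine Fin.cases ?_ (fun l => ?_) k
      · simpa [hSv] using hJ
      · simpa [hSv] using hPs l
  have hdv0 : dv 0 = d₀ + a + b := by simp [hdv]
  have hdv1 : dv 1 = d₀ + a := by simp [hdv]
  have hdvl : ∀ l : Fin L, dv l.succ.succ = d₀ + γ l := by intro l; simp [hdv]
  have hmin : ∀ k : Fin (L + 2), k ≠ l₀.succ.succ → dv l₀.succ.succ < dv k := by
    intro k hk
    rw [hdvl l₀]
    revert hk
    refine Fin.cases ?_ (fun k => ?_) k
    · intro _; rw [hdv0]; have := hγa l₀; omega
    · refine Fin.cases ?_ (fun l => ?_) k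
      · intro _; show d₀ + γ l₀ < dv 1; rw [hdv1]; have := hγa l₀; omega
      · intro hne
        rw [hdvl]
        have hl : l ≠ l₀ := fun h => hne (by rw [h])
        have := hγbot l hl
        omega
  have hmax : ∀ k : Fin (L + 2), k ≠ 0 → dv k < dv 0 := by
    intro k hk
    rw [hdv0]
    revert hk
    refine Fin.cases ?_ (fun k => ?_) k
    · intro h; exact absurd rfl h
    · intro _
      refine Fin.cases ?_ (fun l => ?_) k
      · show dv 1 < d₀ + a + b; rw [hdv1]; omega
      · rw [hdvl]; have := hγa l; omega
  have h0 : (Sv l₀.succ.succ).det ≠ 0 := by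
    show (Matrix.vecCons C (Matrix.vecCons J P) l₀.succ.succ).det ≠ 0
    simp only [Matrix.cons_val_succ]; exact hbot.det_pos.ne'
  have h2 : (Sv 0).det ≠ 0 := by
    show (Matrix.vecCons C (Matrix.vecCons J P) 0).det ≠ 0
    simp only [Matrix.cons_val_zero]; exact hC.det_pos.ne'
  let negType : ℝ → Prop := fun t => ∀ u : Fin m → ℝ, (∑ k, t ^ dv k • Sv k) *ᵥ u = 0 → u ≠ 0 →
    (derivative (∑ k, Polynomial.C (u ⬝ᵥ (Sv k *ᵥ u)) * (X : ℝ[X]) ^ dv k)).eval t < 0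
  obtain ⟨hidx, -, hsum⟩ := Inertia.global_index_formula dv Sv hS l₀.succ.succ 0 hmin hmax h0 h2 htype negType
    (fun t _ _ => Iff.rfl)
  have hνbot : Fintype.card {j // (Inertia.isHermitian_of_isSymm (hS l₀.succ.succ)).eigenvalues j < 0} = 0 := by
    rw [Fintype.card_eq_zero_iff]
    refine ⟨fun ⟨j, hj⟩ => ?_⟩
    have hbot' : (Sv l₀.succ.succ).PosDef := by
      show (Matrix.vecCons C (Matrix.vecCons J P) l₀.succ.succ).PosDef
      simp only [Matrix.cons_val_succ]; exact hbot
    have hp : 0 < (Inertia.isHermitian_of_isSymm (hS l₀.succ.succ)).eigenvalues j := hbot'.eigenvalues_pos j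
    linarith
  have hνtop : Fintype.card {j // (Inertia.isHermitian_of_isSymm (hS 0)).eigenvalues j < 0} = 0 := by
    rw [Fintype.card_eq_zero_iff]
    refine ⟨fun ⟨j, hj⟩ => ?_⟩
    have hC' : (Sv 0).PosDef := by
      show (Matrix.vecCons C (Matrix.vecCons J P) 0).PosDef
      simp only [Matrix.cons_val_zero]; exact hC
    have hp : 0 < (Inertia.isHermitian_of_isSymm (hS 0)).eigenvalues j := hC'.eigenvalues_pos j
    linarith
  rw [hνbot, hνtop, zero_add, zero_add] at hidx
  set Pd := Matrix.det (∑ k, ((X : ℝ[X]) ^ dv k) • (Sv k).map Polynomial.C) with hPd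
  set q : ℝ → Prop := fun t => 0 < t ∧ ¬ negType t with hq
  set T := Pd.roots.toFinset.filter q with hTdef
  have hTpos : ∀ t ∈ T, 0 < t := fun t ht => (Finset.mem_filter.mp ht).2.1
  have hdetT : ∀ t ∈ T, (∑ k, t ^ dv k • Sv k).det = 0 := by
    intro t ht
    obtain ⟨hmem, -⟩ := Finset.mem_filter.mp ht
    obtain ⟨-, hroot⟩ := (Polynomial.mem_roots').mp (Multiset.mem_toFinset.mp hmem)
    have h1 : Pd.eval t = 0 := hroot
    rwa [hPd, DefiniteMoments.eval_det_pencil] at h1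
  have hdef : ∀ t ∈ T, ∀ v : Fin m → ℝ, (∑ k, t ^ dv k • Sv k) *ᵥ v = 0 → v ≠ 0 →
      (derivative (∑ k, Polynomial.C (v ⬝ᵥ (Sv k *ᵥ v)) * (X : ℝ[X]) ^ dv k)).eval t ≠ 0 := by
    intro t ht v hv hv0
    rcases htype t (hTpos t ht) (hdetT t ht) with h | h
    · exact ne_of_lt (h v hv hv0)
    · exact ne_of_gt (h v hv hv0)
  have hN : ∑ t ∈ T, (Fintype.card (Fin m) - (∑ k, t ^ dv k • Sv k).rank) = Multiset.card (Pd.roots.filter q) :=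
    Inertia.sum_corank_eq_card_roots_filter dv Sv hS q hdef
  have hTtype : ∀ t ∈ T, ∀ u : Fin m → ℝ, (∑ k, t ^ dv k • Sv k) *ᵥ u = 0 → u ≠ 0 →
      0 < (derivative (∑ k, Polynomial.C (u ⬝ᵥ (Sv k *ᵥ u)) * (X : ℝ[X]) ^ dv k)).eval t := by
    intro t ht u hu hu0
    have htq := (Finset.mem_filter.mp ht).2
    rcases htype t htq.1 (hdetT t ht) with hneg | hposT
    · exact absurd hneg htq.2
    · exact hposT u hu hu0
  -- orthogonal kernel families for the type form `b t^{a+b} C − Σₗ (a − γₗ) t^{γₗ} Pₗ`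
  have hfam : ∀ t : ℝ, ∃ v : Fin (m - (∑ k, t ^ dv k • Sv k).rank) → (Fin m → ℝ),
      (∀ j, (∑ k, t ^ dv k • Sv k) *ᵥ v j = 0) ∧ (∀ j, v j ≠ 0) ∧
      ∀ j j', j ≠ j' → v j ⬝ᵥ ((((b : ℝ) * t ^ (a + b)) • C - ∑ l, (((a - γ l : ℕ) : ℝ) * t ^ γ l) • P l) *ᵥ v j') = 0 := by
    intro t
    refine exists_kernel_orthogonal_family _ _ ?_
    unfold Matrix.IsSymm
    rw [Matrix.transpose_sub, Matrix.transpose_smul, Matrix.transpose_sum, hCs]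
    congr 1
    exact Finset.sum_congr rfl fun l _ => by rw [Matrix.transpose_smul, hPs l]
  choose v hv0 hvne hvorth using hfam
  have hpol : ∀ t : ℝ, ∀ j j', j ≠ j' →
      (b : ℝ) * t ^ (a + b) * (v t j ⬝ᵥ (C *ᵥ v t j')) = ∑ l, ((a - γ l : ℕ) : ℝ) * t ^ γ l * (v t j ⬝ᵥ (P l *ᵥ v t j')) := by
    intro t j j' hjj
    have h := hvorth t j j' hjj
    rw [Matrix.sub_mulVec, Matrix.smul_mulVec, Matrix.sum_mulVec, dotProduct_sub, dotProduct_smul, dotProduct_sum,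
      smul_eq_mul, sub_eq_zero] at h
    rw [h]
    refine Finset.sum_congr rfl fun l _ => ?_
    rw [Matrix.smul_mulVec, dotProduct_smul, smul_eq_mul]
  let Idx := Σ t : T, Fin (m - (∑ k, (t : ℝ) ^ dv k • Sv k).rank)
  have hcard : Fintype.card Idx = ∑ t ∈ T, (Fintype.card (Fin m) - (∑ k, t ^ dv k • Sv k).rank) := by
    rw [Fintype.card_sigma]
    simp only [Fintype.card_fin]
    exact (Finset.sum_coe_sort T (fun t => m - (∑ k, t ^ dv k • Sv k).rank))
  have hbound : Fintype.card Idx ≤ R := by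
    refine hlaw Idx (fun p => ((p.1 : ℝ))) (fun p => v p.1 p.2) (fun p => hTpos p.1 p.1.2)
      (fun p => reduced_kernel_clustered_lower C J P d₀ a b γ (hTpos p.1 p.1.2) _ (hv0 p.1 p.2)) ?_ ?_
    · intro p
      have ht := hTpos p.1 p.1.2
      have hpos := hTtype p.1 p.1.2 (v p.1 p.2) (hv0 p.1 p.2) (hvne p.1 p.2)
      have heq := rayleigh_deriv_eq_clustered_lower C J P d₀ a b γ (fun l => (hγa l).le) ht _ (hv0 p.1 p.2)
      have h1 : 0 < (p.1 : ℝ) * (derivative (∑ k : Fin (L + 2),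
          Polynomial.C (v p.1 p.2 ⬝ᵥ ((Matrix.vecCons C (Matrix.vecCons J P) k) *ᵥ v p.1 p.2)) *
          (X : ℝ[X]) ^ (Matrix.vecCons (d₀ + a + b) (Matrix.vecCons (d₀ + a) fun l => d₀ + γ l) k))).eval (p.1 : ℝ) :=
        mul_pos ht hpos
      rw [heq] at h1
      have h2 : 0 < (p.1 : ℝ) ^ d₀ := pow_pos ht _
      by_contra hcon
      push Not at hcon
      have h3 : (b : ℝ) * ((p.1 : ℝ)) ^ (a + b) * (v p.1 p.2 ⬝ᵥ (C *ᵥ v p.1 p.2))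
          - ∑ l, ((a - γ l : ℕ) : ℝ) * ((p.1 : ℝ)) ^ γ l * (v p.1 p.2 ⬝ᵥ (P l *ᵥ v p.1 p.2)) ≤ 0 := by linarith
      have := mul_nonpos_of_nonneg_of_nonpos h2.le h3
      linarith
    · rintro ⟨t, j⟩ ⟨t', j'⟩ hne htt'
      simp only at htt'
      have htt : t = t' := Subtype.ext htt'
      subst htt
      have hjj : j ≠ j' := fun h => hne (by subst h; rfl)
      exact hpol t j j' hjj
  rw [← hsum]
  have hNle : Multiset.card (Pd.roots.filter q) ≤ R := by
    rw [← hN, ← hcard]; exact hbound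
  have hidx' : Multiset.card (Pd.roots.filter fun t => 0 < t ∧ negType t) = Multiset.card (Pd.roots.filter q) := hidx.symm
  rw [hidx']
  omega

/-- **clustered LOWER letters, any length, DEFINITE TYPE (any corank)**: `Z₊ ≤ 2m`. [folklore] -/
theorem card_posRoots_le_two_mul_clustered_lower_of_definite (C J : Matrix (Fin m) (Fin m) ℝ)
    (P : Fin L → Matrix (Fin m) (Fin m) ℝ) (hC : C.PosDef) (hJ : J.IsSymm) (hP : ∀ l, (P l).PosSemidef) (l₀ : Fin L)
    (hbot : (P l₀).PosDef) (d₀ a b : ℕ) (γ : Fin L → ℕ) (hb : 0 < b) (hγ : ∀ l, γ l < a ∧ a ≤ γ l + b)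
    (hγbot : ∀ l, l ≠ l₀ → γ l₀ < γ l)
    (htype : ∀ t : ℝ, 0 < t →
      (∑ k : Fin (L + 2), t ^ (Matrix.vecCons (d₀ + a + b) (Matrix.vecCons (d₀ + a) fun l => d₀ + γ l) k) •
        (Matrix.vecCons C (Matrix.vecCons J P) k)).det = 0 →
      (∀ u : Fin m → ℝ, (∑ k : Fin (L + 2), t ^ (Matrix.vecCons (d₀ + a + b) (Matrix.vecCons (d₀ + a) fun l => d₀ + γ l) k) •
          (Matrix.vecCons C (Matrix.vecCons J P) k)) *ᵥ u = 0 → u ≠ 0 →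
        (derivative (∑ k : Fin (L + 2), Polynomial.C (u ⬝ᵥ ((Matrix.vecCons C (Matrix.vecCons J P) k) *ᵥ u)) *
          (X : ℝ[X]) ^ (Matrix.vecCons (d₀ + a + b) (Matrix.vecCons (d₀ + a) fun l => d₀ + γ l) k))).eval t < 0) ∨
      (∀ u : Fin m → ℝ, (∑ k : Fin (L + 2), t ^ (Matrix.vecCons (d₀ + a + b) (Matrix.vecCons (d₀ + a) fun l => d₀ + γ l) k) •
          (Matrix.vecCons C (Matrix.vecCons J P) k)) *ᵥ u = 0 → u ≠ 0 →
        0 < (derivative (∑ k : Fin (L + 2), Polynomial.C (u ⬝ᵥ ((Matrix.vecCons C (Matrix.vecCons J P) k) *ᵥ u)) *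
          (X : ℝ[X]) ^ (Matrix.vecCons (d₀ + a + b) (Matrix.vecCons (d₀ + a) fun l => d₀ + γ l) k))).eval t)) :
    Multiset.card ((Matrix.det (∑ k : Fin (L + 2),
        ((X : ℝ[X]) ^ (Matrix.vecCons (d₀ + a + b) (Matrix.vecCons (d₀ + a) fun l => d₀ + γ l) k)) •
          (Matrix.vecCons C (Matrix.vecCons J P) k).map Polynomial.C)).roots.filter (fun t => 0 < t)) ≤ 2 * m := by
  have h := card_posRoots_le_of_posType_family_law_lower C J P hC hJ hP l₀ hbot d₀ a b γ hb (fun l => (hγ l).1) hγbot C.rank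
    (fun I _ _ τ u hτ hker hty hsame =>
      card_posType_family_le_rank_clustered_lower C J P a b γ τ u hC.posSemidef hJ hP hτ hb hγ hker hty hsame) htype
  exact h.trans (Nat.mul_le_mul_left 2 ((Matrix.rank_le_width C).trans le_rfl))

/-- **LOWER letters at multiples of the top gap, DEFINITE TYPE (any corank), SHARP constant**: `Z₊ ≤ 2(m + m Σₗ ⌊qₗ/2⌋)`. [folklore] -/
theorem card_posRoots_le_commensurable_lower_of_definite (C J : Matrix (Fin m) (Fin m) ℝ)
    (P : Fin L → Matrix (Fin m) (Fin m) ℝ) (hC : C.PosDef) (hJ : J.IsSymm) (hP : ∀ l, (P l).PosSemidef) (l₀ : Fin L)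
    (hbot : (P l₀).PosDef) (d₀ a b : ℕ) (γ q : Fin L → ℕ) (hb : 0 < b) (hq : ∀ l, 1 ≤ q l) (hγ : ∀ l, γ l + b * q l = a)
    (hqbot : ∀ l, l ≠ l₀ → q l < q l₀)
    (htype : ∀ t : ℝ, 0 < t →
      (∑ k : Fin (L + 2), t ^ (Matrix.vecCons (d₀ + a + b) (Matrix.vecCons (d₀ + a) fun l => d₀ + γ l) k) •
        (Matrix.vecCons C (Matrix.vecCons J P) k)).det = 0 →
      (∀ u : Fin m → ℝ, (∑ k : Fin (L + 2), t ^ (Matrix.vecCons (d₀ + a + b) (Matrix.vecCons (d₀ + a) fun l => d₀ + γ l) k) •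
          (Matrix.vecCons C (Matrix.vecCons J P) k)) *ᵥ u = 0 → u ≠ 0 →
        (derivative (∑ k : Fin (L + 2), Polynomial.C (u ⬝ᵥ ((Matrix.vecCons C (Matrix.vecCons J P) k) *ᵥ u)) *
          (X : ℝ[X]) ^ (Matrix.vecCons (d₀ + a + b) (Matrix.vecCons (d₀ + a) fun l => d₀ + γ l) k))).eval t < 0) ∨
      (∀ u : Fin m → ℝ, (∑ k : Fin (L + 2), t ^ (Matrix.vecCons (d₀ + a + b) (Matrix.vecCons (d₀ + a) fun l => d₀ + γ l) k) •
          (Matrix.vecCons C (Matrix.vecCons J P) k)) *ᵥ u = 0 → u ≠ 0 →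
        0 < (derivative (∑ k : Fin (L + 2), Polynomial.C (u ⬝ᵥ ((Matrix.vecCons C (Matrix.vecCons J P) k) *ᵥ u)) *
          (X : ℝ[X]) ^ (Matrix.vecCons (d₀ + a + b) (Matrix.vecCons (d₀ + a) fun l => d₀ + γ l) k))).eval t)) :
    Multiset.card ((Matrix.det (∑ k : Fin (L + 2),
        ((X : ℝ[X]) ^ (Matrix.vecCons (d₀ + a + b) (Matrix.vecCons (d₀ + a) fun l => d₀ + γ l) k)) •
          (Matrix.vecCons C (Matrix.vecCons J P) k).map Polynomial.C)).roots.filter (fun t => 0 < t))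
      ≤ 2 * (m + m * ∑ l, q l / 2) := by
  have hγlt : ∀ l, γ l < a := by
    intro l; have := hγ l
    have : b * 1 ≤ b * q l := Nat.mul_le_mul_left b (hq l)
    omega
  have hγbot : ∀ l, l ≠ l₀ → γ l₀ < γ l := by
    intro l hl
    have h1 := hγ l; have h2 := hγ l₀
    have h3 : b * q l < b * q l₀ := Nat.mul_lt_mul_of_pos_left (hqbot l hl) hb
    omega
  have h := card_posRoots_le_of_posType_family_law_lower C J P hC hJ hP l₀ hbot d₀ a b γ hb hγlt hγbot
    (C.rank + ∑ l, (q l / 2) * (P l).rank)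
    (fun I _ _ τ u hτ hker hty hsame =>
      card_posType_family_le_rank_commensurable_lower_sharp C J P a b γ q τ u hC.posSemidef hJ hP hτ hb hq hγ hker hty hsame)
    htype
  refine h.trans (Nat.mul_le_mul_left 2 (Nat.add_le_add ((Matrix.rank_le_width C).trans le_rfl) ?_))
  rw [Finset.mul_sum]
  exact Finset.sum_le_sum fun l _ => by
    calc q l / 2 * (P l).rank ≤ q l / 2 * m := Nat.mul_le_mul_left _ ((Matrix.rank_le_width (P l)).trans le_rfl)
      _ = m * (q l / 2) := Nat.mul_comm _ _

end LowerDefiniteAny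

end TwoSidedThree

end Summit.ValiantsHypothesis.ValiantsHypothesis.Theorems.KPlusLogSqLaw.TowerGraft
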